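import Summits.QuantumAdvantage.AdviceFreeQNC0.FibreDecimation38F
import HarnessLib

/-!
# Exp38p2 — Lemma 38.C as a stand-alone statement (`MixedParityCount`, planner p2 g38's custody delta v2, sha e73249cb4521b0c9) — typed
# verbatim and DISCHARGED

The tree's `SubRowDecimation38C.lean` is the port of v1 (a5f2f9b9747ffbc2) of planner qa-qnc0-p2 g38's corrected typing; v2 added ONE
declaration, the typed target `MixedParityCount` (Lemma 38.C in the interface of `Exp37.card_parityClass_filter_le`).  It is recorded here
verbatim and proved from `Exp37.card_parityClass_filter_le_mixed` (`FibreDecimation37MixedCount.lean`, via the presentation-free form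
`Exp38p2.card_parityClass_filter_le_mixed'` of `FibreDecimation38F.lean`): **`mixedParityCount : MixedParityCount`**.

WHAT THIS IS NOT: nothing new mathematically; no statement about the game.
-/

noncomputable section

open Classical

namespace Summit.QuantumAdvantage.AdviceFreeQNC0.Exp38p2

open Finset
open Summit.QuantumAdvantage.AdviceFreeQNC0 F4
open Summit.QuantumAdvantage.AdviceFreeQNC0.Exp37
open Literature.Computability.MetaComplexity

/-! ### Lemma 38.C as a stand-alone character-sum statement — the MIXED-NORM parity-class count (target) -/

/-- **Lemma 38.C (mixed-norm parity-class count; target, in the interface of the tree's `Exp37.card_parityClass_filter_le`).**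
Tests `[ℓ_k(u) ∈ A_k]` on `u ∈ {0,1}^ι`; off `J` the tests are trivial (`A_k = ∅`; always-accepting tests are folded into `c`
by the user, as `Exp37.cStar` does), and ON `J` EVERY test is genuine (`∅ ≠ A_k ≠ univ`: this is `J = J'_ε`; a constant test has
`|â_k(0)| = 1` and breaks the short-mass bound — the point of the v9 correction); short mass `S(|J|, s₀) ≤ 1/10`; long `3/4`-mass
over the coefficient patterns supported on `J` of support `> s₀` at most `1/100`.  Then on either parity class the number of
accepting tests has a prescribed parity on at most `(7/8)·2^{|ι|−1}` points.  (`J ≠ ∅` is implied: `S(0,s₀) = 1`.)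
Proof route (memo §1.3): as `Exp37.norm_twisted_sum_le`, but split the non-zero patterns `s`: support `≤ s₀` in `L¹`
(`|a_{k,0}| = 1/3`, `|a_{k,t}| = 2/3` for `t ≠ 0`, so `Σ_{|supp s| ≤ s₀}|ĉ_s| ≤ S(|J|,s₀)`, each twisted factor `≤ 1`), support
`> s₀` by Cauchy–Schwarz against `Σ_s|ĉ_s|² = 1`; hence `‖T_t‖ ≤ 2^{|ι|}((t = 0 ? 1/3 : 0) + 1/10 + 1/10)`,
`|Σ_{E_p}(−1)^{#acc}| ≤ (11/15)·2^{|ι|−1}` and the count is `≤ (13/15)·2^{|ι|−1} ≤ (7/8)·2^{|ι|−1}`.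
With `J := ` the genuine decoded rows (`decimSetE`, through `Exp37.dirOut`/`accSet`) and the glue of `FibreDecimation37NHFibre`
this gives `FibreNonExact38E` exactly as `card_parityClass_filter_le` gives `fibreNonExact37NH_of_three_le`. -/
def MixedParityCount : Prop :=
  ∀ (ι : Type) [Fintype ι] [DecidableEq ι] (κ : Type) [Fintype κ] [DecidableEq κ]
    (δ : κ → ι → ZMod 3) (A : κ → Finset (ZMod 3)) (J : Finset κ) (s₀ : ℕ),
    (∀ k, k ∉ J → A k = ∅) → (∀ k ∈ J, (A k).Nonempty ∧ A k ≠ univ) →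
    0 < Fintype.card ι →
    shortMass J.card s₀ ≤ 1 / 10 →
    (∑ s ∈ univ.filter (fun s : κ → ZMod 3 => s₀ < (univ.filter fun k => s k ≠ 0).card ∧ ∀ k, k ∉ J → s k = 0),
        ((3 : ℝ) / 4) ^ ModTestProduct.wt (ModTestProduct.combo δ s)) ≤ 1 / 100 →
    ∀ p c : ℕ,
      ((univ.filter fun u : ι → Bool =>
          (univ.filter fun i => u i = true).card % 2 = p % 2 ∧
          (univ.filter fun k => ModTestProduct.subsetSum (δ k) u ∈ A k).card % 2 = c % 2).card : ℝ)
        ≤ 7 / 8 * (2 : ℝ) ^ (Fintype.card ι - 1)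


/-- **Lemma 38.C (`MixedParityCount`) — PROVED.** -/
theorem mixedParityCount : MixedParityCount := by
  intro ι _ _ κ _ _ δ A J s₀ hJ hgen hι hshort hlong p c
  refine card_parityClass_filter_le_mixed' δ A J hgen (fun k hk h => ?_) hι s₀ (by unfold shortMass at hshort; exact hshort) _
    (fun s' => by unfold ModTestProduct.wt; simp only [mem_filter, mem_univ, true_and]) hlong p c
  rw [hJ k hk] at h
  exact not_nonempty_empty h.1

end Summit.QuantumAdvantage.AdviceFreeQNC0.Exp38p2

end
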